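import Summits.PneNP.PneNP.Theorems.SymmetryBudgetNoHiddenOrderPerPathCanon

/-!
# The canonical copy is REALISED (`NoHiddenOrder`, PER-PATH.md §12.2, brick B2 — realisation)

Route `PneNP/SymmetryBudget`, `NoHiddenOrder` (stmt-PneNP-14781). For the components-only Corneil–Goldberg canonical copy
`canon G A col : Enc` of `SymmetryBudgetNoHiddenOrderPerPathCanon.lean` (B. Laubner, PhD thesis HU Berlin 2011, §3.4 with
component sections only) we prove that it IS a copy of the coloured block: whenever `col` is equitable inside `A` (the standing
invariant of the process — root `refineIn`, AND-children by `equitableIn_of_swClosed`, OR-children by `equitableIn_refineIn`),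

  `canon G A col = encOf G col l` for some enumeration `l` of `A` (`exists_canon_eq_encOf`),

where `encOf G col l` lists the rows `(col u, [u ~ w | w ← l])` along `l`. The three cases of the recursion: a leaf is its own
copy; at an AND-node the sorted copies of the switching components glue to the copy of their concatenation because the cross data
between two components is uniform (`assembleAND_map_encOf`: no switching edge leaves a component, so `u ~ w ↔ SwComp u w`, a
function of the two colours); at an OR-node the lex-least candidate is one of the candidates, each a recoloured copy for a finer
colouring (`recolour_encOf`, `colMap` inverts the refinement on `A`). The degenerate branch is unreachable under equitability
(a singleton cell is switching-isolated, `not_swAdj_of_cell_singleton`).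

Main definitions: `encOf`. Main results: `assembleAND_map_encOf`, `exists_canon_eq_encOf`, and the decoding direction
`exists_matching_enum_of_canon_eq` (equal canonical copies ⇒ the coloured blocks are isomorphic). Relabelling invariance (the
converse) is the next brick.
-/

-- `Summit.PneNP.PneNP.…` duplicates `PneNP` BY DESIGN (single-problem summit, D-0017 layout).
set_option linter.dupNamespace false

namespace Summit.PneNP.PneNP.Theorems

open Finset

namespace BranchSum

variable {V : Type*} [DecidableEq V] (G : SimpleGraph V) [DecidableRel G.Adj]

/-- The encoding of `G` coloured by `col` read along the vertex list `l`: row `u` is `(col u, [u ~ w | w ← l])`. -/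
def encOf (col : V → ℕ) (l : List V) : Enc := l.map fun u => toLex (col u, l.map fun w => decide (G.Adj u w))

variable {G}

omit [DecidableEq V] in
/-- Renaming the colours of a realised encoding realises the renamed colouring. -/
theorem recolour_encOf (f : ℕ → ℕ) (col : V → ℕ) (l : List V) :
    recolour f (encOf G col l) = encOf G (f ∘ col) l := by
  simp [recolour, encOf, List.map_map, Function.comp_def]

omit [DecidableEq V] in
/-- Realised encodings depend only on the colours of the listed vertices. -/
theorem encOf_congr {col col' : V → ℕ} {l : List V} (h : ∀ u ∈ l, col u = col' u) : encOf G col l = encOf G col' l :=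
  List.map_congr_left fun u hu => by rw [h u hu]

/-- Mapping over the members of a list of lists, positionally. -/
private theorem map_map_eq_zipIdx_map {α β : Type*} (L : List (List α)) (g : α → β) :
    L.map (List.map g) = L.zipIdx.map fun li => li.1.map g := by
  conv_lhs => rw [← List.zipIdx_map_fst 0 L, List.map_map]
  rfl

omit [DecidableEq V] in
/-- **Assembly realises.** Gluing the realised encodings of blocks whose mutual cross data is uniform (`u ~ w ↔ sw (col u)
(col w)` across two different blocks) realises the concatenation of the blocks. -/
theorem assembleAND_map_encOf (sw : ℕ → ℕ → Bool) (col : V → ℕ) (L : List (List V))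
    (hL : L.Pairwise fun l₁ l₂ => ∀ u ∈ l₁, ∀ w ∈ l₂,
      decide (G.Adj u w) = sw (col u) (col w) ∧ decide (G.Adj w u) = sw (col w) (col u)) :
    assembleAND sw (L.map (encOf G col)) = encOf G col L.flatten := by
  -- cross data read at positions `i ≠ j`
  have hcross : ∀ i j (hi : i < L.length) (hj : j < L.length), i ≠ j → ∀ u ∈ L[j], ∀ w ∈ L[i],
      sw (col u) (col w) = decide (G.Adj u w) := by
    intro i j hi hj hij u hu w hw
    rcases Nat.lt_or_gt_of_ne hij with h | h
    · exact ((List.pairwise_iff_getElem.1 hL i j hi hj h) w hw u hu).2.symm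
    · exact ((List.pairwise_iff_getElem.1 hL j i hj hi h) u hu w hw).1.symm
  unfold assembleAND
  simp only [List.zipIdx_map, List.flatMap_map, Prod.map_fst, Prod.map_snd, id_eq, encOf, crossRow, List.map_map,
    Function.comp_def, ofLex_toLex]
  rw [List.map_flatten, map_map_eq_zipIdx_map, List.flatMap_def]
  congr 1
  refine List.map_congr_left ?_
  rintro ⟨l, j⟩ hlj
  obtain ⟨hj, hl⟩ := List.mem_zipIdx' hlj
  dsimp only
  refine List.map_congr_left fun u hu => ?_
  have hu' : u ∈ L[j] := hl ▸ hu
  refine congrArg (fun row => toLex (col u, row)) ?_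
  rw [List.map_flatten, map_map_eq_zipIdx_map, List.flatMap_def]
  congr 1
  refine List.map_congr_left ?_
  rintro ⟨l', i⟩ hli
  obtain ⟨hi, hl'⟩ := List.mem_zipIdx' hli
  dsimp only
  split_ifs with hij
  · subst hij; rw [hl, hl']
  · exact List.map_congr_left fun w hw => hcross i j hi hj hij u hu' w (hl' ▸ hw)

/-- **REALISATION of the canonical copy.** If `col` is equitable inside `A`, then `canon G A col` is the encoding of
`(A, col)` read along some enumeration of `A`. -/
theorem exists_canon_eq_encOf_aux (A : Finset V) (col : V → ℕ)
    (heq : ∀ u ∈ A, ∀ v ∈ A, col u = col v → ∀ w ∈ A,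
      ((cellOf A col w).filter fun y => G.Adj u y).card = ((cellOf A col w).filter fun y => G.Adj v y).card) :
    ∃ l : List V, l.Nodup ∧ (∀ u, u ∈ l ↔ u ∈ A) ∧ canon G A col = encOf G col l := by
  suffices h : ∀ (n : ℕ) (A : Finset V) (col : V → ℕ), canonMeasure A col = n →
      (∀ u ∈ A, ∀ v ∈ A, col u = col v → ∀ w ∈ A,
        ((cellOf A col w).filter fun y => G.Adj u y).card = ((cellOf A col w).filter fun y => G.Adj v y).card) →
      ∃ l : List V, l.Nodup ∧ (∀ u, u ∈ l ↔ u ∈ A) ∧ canon G A col = encOf G col l from h _ A col rfl heq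
  intro n
  induction n using Nat.strong_induction_on with
  | _ n ih =>
  intro A col hn heq
  rw [canon]
  split_ifs with h1 hAND hOR
  · -- leaf
    refine ⟨A.toList, A.nodup_toList, fun u => mem_toList, ?_⟩
    rcases A.eq_empty_or_nonempty with rfl | hne
    · simp [encOf]
    · obtain ⟨a, rfl⟩ := card_eq_one.1 (le_antisymm h1 hne.card_pos)
      simp [encOf, toList_singleton]
  · -- AND: the switching components are realised by induction
    have hcl : ∀ w, ∀ a ∈ swReach G A col w, ∀ b ∈ A, (swGraph G A col).Adj a b → b ∈ swReach G A col w :=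
      fun w a ha b hb hab => swReach_closed col w ha hb hab
    have hch : ∀ K : {K // K ∈ A.image fun u => swReach G A col u},
        ∃ l : List V, l.Nodup ∧ (∀ u, u ∈ l ↔ u ∈ K.1) ∧ canon G K.1 col = encOf G col l := by
      rintro ⟨K, hK⟩
      obtain ⟨w, hw, rfl⟩ := mem_image.1 hK
      refine ih _ (hn ▸ canonMeasure_lt_of_card_lt col col (card_swReach_lt_of_disconnected hAND hK)) _ _ rfl ?_
      intro u hu v hv huv z hz
      exact equitableIn_of_swClosed G (swReach_subset A col w) (hcl w) heq hu hv huv hz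
    choose f hf using hch
    set Ks := (A.image fun u => swReach G A col u).attach.toList with hKs
    -- the sorted copies are the copies of a listing `L` of the realising enumerations
    have hmap : Ks.map (fun K => canon G K.1 col) = (Ks.map f).map (encOf G col) := by
      rw [List.map_map]; exact List.map_congr_left fun K _ => (hf K).2.2
    obtain ⟨L, hL, hLperm⟩ : Relation.Comp (· = List.map (encOf G col) ·) List.Perm
        ((Ks.map fun K => canon G K.1 col).insertionSort (· ≤ ·)) (Ks.map f) := by
      rw [List.eq_map_comp_perm]
      exact (List.perm_insertionSort _ _).trans (List.Perm.of_eq hmap)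
    have hmemL : ∀ l ∈ L, ∃ K, K ∈ Ks ∧ f K = l := fun l hl => List.mem_map.1 (hLperm.subset hl)
    -- two distinct components are disjoint with uniform cross data
    have hdist : ∀ K K' : {K // K ∈ A.image fun u => swReach G A col u}, K ≠ K' →
        ∀ u ∈ K.1, ∀ w ∈ K'.1, u ≠ w ∧ ¬ (swGraph G A col).Adj u w := by
      rintro ⟨K, hK⟩ ⟨K', hK'⟩ hne u hu w hw
      obtain ⟨a, ha, rfl⟩ := mem_image.1 hK
      obtain ⟨b, hb, rfl⟩ := mem_image.1 hK'
      have hKu : swReach G A col u = swReach G A col a := swReach_eq_of_mem col ha hu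
      have hKw : swReach G A col w = swReach G A col b := swReach_eq_of_mem col hb hw
      refine ⟨?_, fun hadj => ?_⟩
      · rintro rfl; exact hne (Subtype.ext (hKu.symm.trans hKw))
      · have hw' : w ∈ swReach G A col a := swReach_closed col a hu (swReach_subset A col b hw) hadj
        exact hne (Subtype.ext ((swReach_eq_of_mem col ha hw').symm.trans hKw))
    have hadj_iff : ∀ K K' : {K // K ∈ A.image fun u => swReach G A col u}, K ≠ K' →
        ∀ u ∈ K.1, ∀ w ∈ K'.1, (G.Adj u w ↔ SwComp G A col u w) := by
      intro K K' hne u hu w hw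
      obtain ⟨hne', hnadj⟩ := hdist K K' hne u hu w hw
      rw [swGraph_adj] at hnadj
      by_contra h
      exact hnadj ⟨hne', by tauto⟩
    have hpwKs : (Ks.map f).Pairwise fun l₁ l₂ =>
        (∀ u ∈ l₁, ∀ w ∈ l₂, decide (G.Adj u w) = decide (SwCompC G A col (col u) (col w)) ∧
          decide (G.Adj w u) = decide (SwCompC G A col (col w) (col u))) ∧ List.Disjoint l₁ l₂ := by
      rw [List.pairwise_map]
      refine (nodup_toList _).imp fun {K K'} hne => ?_
      refine ⟨fun u hu w hw => ⟨?_, ?_⟩, fun u hu hu' => ?_⟩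
      · exact decide_eq_decide.2 (hadj_iff K K' hne u (((hf K).2.1 u).1 hu) w (((hf K').2.1 w).1 hw))
      · exact decide_eq_decide.2 (hadj_iff K' K (Ne.symm hne) w (((hf K').2.1 w).1 hw) u (((hf K).2.1 u).1 hu))
      · exact (hdist K K' hne u (((hf K).2.1 u).1 hu) u (((hf K').2.1 u).1 hu')).1 rfl
    have hpwL := (hLperm.pairwise_iff (R := fun l₁ l₂ =>
        (∀ u ∈ l₁, ∀ w ∈ l₂, decide (G.Adj u w) = decide (SwCompC G A col (col u) (col w)) ∧
          decide (G.Adj w u) = decide (SwCompC G A col (col w) (col u))) ∧ List.Disjoint l₁ l₂)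
      (fun {x y} h => ⟨fun u hu w hw => ⟨((h.1 w hw u hu).2), (h.1 w hw u hu).1⟩, h.2.symm⟩)).2 hpwKs
    refine ⟨L.flatten, ?_, fun u => ?_, ?_⟩
    · rw [List.nodup_flatten]
      refine ⟨fun l hl => ?_, hpwL.imp fun h => h.2⟩
      obtain ⟨K, -, rfl⟩ := hmemL l hl
      exact (hf K).1
    · rw [List.mem_flatten]
      constructor
      · rintro ⟨l, hl, hul⟩
        obtain ⟨K, -, rfl⟩ := hmemL l hl
        obtain ⟨a, -, ha⟩ := mem_image.1 K.2
        exact swReach_subset A col a (ha ▸ ((hf K).2.1 u).1 hul)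
      · intro hu
        let K₀ : {K // K ∈ A.image fun u => swReach G A col u} := ⟨swReach G A col u, mem_image_of_mem _ hu⟩
        have hK₀ : f K₀ ∈ L := hLperm.symm.subset (List.mem_map.2 ⟨K₀, mem_toList.2 (mem_attach _ _), rfl⟩)
        exact ⟨f K₀, hK₀, ((hf K₀).2.1 u).2 (self_mem_swReach col hu)⟩
    · exact (congrArg (assembleAND _) hL).trans (assembleAND_map_encOf _ col L (hpwL.imp fun h => h.1))
  · -- OR: the lex-least candidate is a candidate, and each candidate is a recoloured copy
    suffices hP : ∀ {ι : Type _} (s : Finset ι) (F : ι → Enc) (H : (s.image F).Nonempty) (P : Enc → Prop),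
        (∀ x ∈ s, P (F x)) → P ((s.image F).min' H) by
      refine hP _ _ _ (fun E => ∃ l : List V, l.Nodup ∧ (∀ u, u ∈ l ↔ u ∈ A) ∧ E = encOf G col l) ?_
      rintro ⟨x, hxS⟩ -
      have hxA : x ∈ A := smallestCell_subset A col hxS
      have h2 : 2 ≤ (cellOf A col x).card := by rw [← smallestCell_eq_cellOf col hxS]; exact hOR
      obtain ⟨l, hl, hlA, hc⟩ := ih _ (hn ▸ canonMeasure_lt_refineIn_indiv (G := G) col hxA h2) A
        (refineIn G A (indiv col x)) rfl (fun u hu v hv huv w hw => equitableIn_refineIn A (indiv col x) hu hv huv hw)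
      refine ⟨l, hl, hlA, ?_⟩
      dsimp only
      rw [hc, recolour_encOf]
      refine encOf_congr fun u hu => ?_
      have huA : u ∈ A := (hlA u).1 hu
      show ((A.filter fun w => refineIn G A (indiv col x) w = refineIn G A (indiv col x) u).image col).sup id = col u
      apply le_antisymm
      · refine Finset.sup_le fun k hk => ?_
        obtain ⟨w, hw, rfl⟩ := mem_image.1 hk
        rw [mem_filter] at hw
        exact (indiv_refines _ _ (refineIn_refines (G := G) _ hw.1 huA hw.2)).le
      · exact le_sup (f := id) (mem_image_of_mem col (mem_filter.2 ⟨huA, rfl⟩))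
    intro ι s F H P h
    obtain ⟨x, hx, e⟩ := mem_image.1 (min'_mem _ H)
    rw [← e]
    exact h x hx
  · -- degenerate branch: unreachable under equitability
    exfalso
    push Not at h1 hAND hOR
    have hAne : A.Nonempty := card_pos.1 (by omega)
    obtain ⟨x, hxS⟩ := smallestCell_nonempty col hAne
    have hxA : x ∈ A := smallestCell_subset A col hxS
    have hsingle : cellOf A col x = {x} := by
      rw [← smallestCell_eq_cellOf col hxS]
      exact eq_singleton_iff_unique_mem.2 ⟨hxS, fun y hy => card_le_one.1 (by omega) y hy x hxS⟩
    have hiso : ∀ b ∈ A, ¬ (swGraph G A col).Adj x b := fun b hb => not_swAdj_of_cell_singleton heq hxA hsingle hb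
    have hsub : swReach G A col x ⊆ {x} :=
      swReach_subset_of_closed col (mem_singleton_self x) fun a ha b hb hab => by
        rw [mem_singleton] at ha; subst ha; exact absurd hab (hiso b hb)
    have := card_le_card hsub
    rw [hAND x hxA, card_singleton] at this
    omega

/-- **REALISATION of the canonical copy** (enumeration form). If `col` is equitable inside `A`, then
`canon G A col = encOf G col l` for a duplicate-free list `l` enumerating exactly `A`. -/
theorem exists_canon_eq_encOf (A : Finset V) (col : V → ℕ)
    (heq : ∀ u ∈ A, ∀ v ∈ A, col u = col v → ∀ w ∈ A,
      ((cellOf A col w).filter fun y => G.Adj u y).card = ((cellOf A col w).filter fun y => G.Adj v y).card) :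
    ∃ l : List V, l.Nodup ∧ l.toFinset = A ∧ canon G A col = encOf G col l := by
  obtain ⟨l, h1, h2, h3⟩ := exists_canon_eq_encOf_aux (G := G) A col heq
  exact ⟨l, h1, by ext u; rw [List.mem_toFinset]; exact h2 u, h3⟩

/-! ### Decoding: equal copies come from isomorphic coloured blocks -/

omit [DecidableEq V] in
/-- Equal realised encodings: the two enumerations have the same length and match colours and adjacency position by
position. -/
theorem col_eq_and_adj_iff_of_encOf_eq {W : Type*} {H : SimpleGraph W} [DecidableRel H.Adj] {col : V → ℕ} {col' : W → ℕ}
    {l : List V} {l' : List W} (h : encOf G col l = encOf H col' l') :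
    ∃ hlen : l.length = l'.length, ∀ i (hi : i < l.length),
      col l[i] = col' (l'[i]'(hlen ▸ hi)) ∧
        ∀ k (hk : k < l.length), (G.Adj l[i] l[k] ↔ H.Adj (l'[i]'(hlen ▸ hi)) (l'[k]'(hlen ▸ hk))) := by
  have hlen : l.length = l'.length := by simpa [encOf] using congrArg List.length h
  refine ⟨hlen, fun i hi => ?_⟩
  have hi' : i < l'.length := hlen ▸ hi
  have hrow := congrArg (fun E : Enc => E[i]?) h
  simp only [encOf, List.getElem?_map, List.getElem?_eq_getElem hi, List.getElem?_eq_getElem hi', Option.map_some,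
    Option.some.injEq, toLex_inj, Prod.mk.injEq] at hrow
  obtain ⟨hc, hr⟩ := hrow
  refine ⟨hc, fun k hk => ?_⟩
  have hk' : k < l'.length := hlen ▸ hk
  have hbit := congrArg (fun r : List Bool => r[k]?) hr
  simp only [List.getElem?_map, List.getElem?_eq_getElem hk, List.getElem?_eq_getElem hk', Option.map_some,
    Option.some.injEq] at hbit
  exact decide_eq_decide.1 hbit

/-- **Equal canonical copies come from isomorphic coloured blocks**: if `canon G A col = canon H B col'` for colourings
equitable inside their blocks, then some enumerations of `A` and `B` match colours and adjacency position by position. -/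
theorem exists_matching_enum_of_canon_eq {W : Type*} [DecidableEq W] {H : SimpleGraph W} [DecidableRel H.Adj]
    {A : Finset V} {col : V → ℕ} {B : Finset W} {col' : W → ℕ}
    (heqA : ∀ u ∈ A, ∀ v ∈ A, col u = col v → ∀ w ∈ A,
      ((cellOf A col w).filter fun y => G.Adj u y).card = ((cellOf A col w).filter fun y => G.Adj v y).card)
    (heqB : ∀ u ∈ B, ∀ v ∈ B, col' u = col' v → ∀ w ∈ B,
      ((cellOf B col' w).filter fun y => H.Adj u y).card = ((cellOf B col' w).filter fun y => H.Adj v y).card)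
    (h : canon G A col = canon H B col') :
    ∃ (l : List V) (l' : List W), l.Nodup ∧ l'.Nodup ∧ l.toFinset = A ∧ l'.toFinset = B ∧
      ∃ hlen : l.length = l'.length, ∀ i (hi : i < l.length),
        col l[i] = col' (l'[i]'(hlen ▸ hi)) ∧
          ∀ k (hk : k < l.length), (G.Adj l[i] l[k] ↔ H.Adj (l'[i]'(hlen ▸ hi)) (l'[k]'(hlen ▸ hk))) := by
  obtain ⟨l, hl, hlA, hcl⟩ := exists_canon_eq_encOf (G := G) A col heqA
  obtain ⟨l', hl', hlB, hcl'⟩ := exists_canon_eq_encOf (G := H) B col' heqB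
  exact ⟨l, l', hl, hl', hlA, hlB, col_eq_and_adj_iff_of_encOf_eq (hcl.symm.trans (h.trans hcl'))⟩

end BranchSum

end Summit.PneNP.PneNP.Theorems
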